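import Mathlib.Algebra.MvPolynomial.Equiv
import Mathlib.Algebra.MvPolynomial.Funext
import Mathlib.Algebra.Polynomial.Roots
import Mathlib.LinearAlgebra.Dimension.Constructions
import Literature.NumberTheory.Transcendental.PhilipponZeroEstimate
import HarnessLib

/-!
# Philippon's zero estimate on `𝔾ₐ × 𝔾ₘⁿ ⊂ (ℙ¹)^{n+1}`, multiplicity-free, with the degree clause

Topic `Literature/NumberTheory/Transcendental`. Decomposition step for the named fact
`Literature.NumberTheory.Transcendental.Diaz1989_zeroLemma` (`DiazZeroLemma.lean`; the zero lemma of
G. Diaz, J. Number Theory 31 (1989), pp. 11–12, "celui de P. Philippon, adapté à la situation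
présente par M. Waldschmidt"), which is Philippon's Théorème 2.1 (Bull. Soc. Math. France 114
(1986)) **in the multiplicity-free case `T = 0`** applied to the linear group
`G = 𝔾ₐ × 𝔾ₘ × ⋯ × 𝔾ₘ` embedded factor by factor in `ℙ¹ × (ℙ¹)ⁿ` (`p = n + 1` factors, so that
the *partial* degrees `D₁` of Diaz's polynomial in each `W_h` are multidegrees), together with two
pieces of information that the tree's first vendoring `Philippon1986_GaGm` (`PhilipponZeroEstimate.lean`:
`G ⊂ ℙ¹ × ℙ^m`, total `Y`-degree, unspecified constant, degree clause dropped, multiplicities kept)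
does not carry and that Diaz's bounds (11), (12) require: the explicit constant `(n+1)!` of
`H(G; D₀, D₁, …, D₁)` and the clause "`G'` incomplètement défini par des équations de multidegrés
`≤ (c₀D₀, …, c_nD_n)`". We vendor that case as the named fact `Philippon1986_GaGm_P1n`, reusing the
group `GaGm n`, its connected algebraic subgroups `ConnAlgSubgroup`, `sumset` and `evalAt` of
`PhilipponZeroEstimate.lean`.

History of the statement (D-0026 review, 2026-08-15). The fact was first vendored (2026-08-14) with
Philippon's multiplicities (an order `T` and an analytic subgroup `A = exp_G(W)`); every user in the
tree (`DiazZeroLemmaProofs.lean` and, through `Diaz1989_zeroLemma_of_P1n`, `DiazThm1FromCh8.lean` and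
`Literature/Barriers/Schanuel/LargeTranscendenceDegreeProofs.lean`) consumes only the case `T = 0`
(`Philippon1986_GaGm_P1n.vanishing`, whose statement is unchanged), which is also the case Diaz's
printed lemma uses (plain vanishing at the points `μ₁v₁ + ⋯ + μ_mv_m`, no derivatives). The fact
was therefore restated as exactly that case: a purely algebraic statement, still a special case of
the printed theorem (weakenings only). The multiplicity version on `𝔾ₐ × 𝔾ₘ^m ⊂ ℙ¹ × ℙ^m` remains
vendored as the independent named fact `Philippon1986_GaGm` (it is no longer derived from this one).

## The printed statement (Philippon 1986, §2, Théorème 2.1, p. 358, verbatim; verified on the page)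

Setting (§2, pp. 357–358): `K = ℂ`; `G = G₁ × ⋯ × G_p`, commutative algebraic groups of
dimensions `n₁, …, n_p`, `n = n₁ + ⋯ + n_p`, `G_i ⊂ ℙ_{N_i}` quasi-projective, `R` the
multihomogeneous coordinate ring of `ℙ = ℙ_{N₁} × ⋯ × ℙ_{N_p}`; `Φ : K^d → G(K)` an analytic
subgroup, `A = im Φ`; `Σ ⊂ G(K)` finite containing the origin, `Σ(n) = {x₁ + ⋯ + x_n ; xᵢ ∈ Σ}`;
`ord_g P` the order at `z = 0` of `z ↦ P(τ_g ∘ Φ(z))`; "une sous-variété `V` de `G` est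
incomplètement définie dans `G` par des équations de multidegrés `≤ (D₁, …, D_p)` si `V` est une
composante irréductible de `G ∩ 𝒵(I)` où `I` est un idéal de `R` engendré par des polynômes de
multidegrés `≤ (D₁, …, D_p)`"; `H(V; d₁, …, d_p) = (dim V)! ×` (top homogeneous part of the
multihomogeneous Hilbert–Samuel polynomial of `V`). "Avec ces notations nous expliciterons dans les
paragraphes 4 et 5 des entiers rationnels `c₁, …, c_p ≥ 1`, où `cᵢ` ne dépend que du plongement de
`Gᵢ` dans `ℙ_{Nᵢ}`, tels que l'on ait le théorème suivant :

THÉORÈME 2.1. — Soit `T ∈ ℕ`, on suppose qu'un polynôme `P` de multidegré `(D₁, …, D_p)` de `R`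
s'annule à un ordre `≥ nT + 1` le long de `A` en chaque point de `Σ(n)`. Alors il existe un
sous-groupe algébrique connexe `G'` de `G`, incomplètement défini dans `G` par des équations
multihomogènes de multidegrés `≤ (c₁D₁, …, c_pD_p)`, contenu dans un translaté de `G ∩ 𝒵(P)` et
tel que : `binom(T + codim_A(A ∩ G'), codim_A(A ∩ G')) · card((Σ + G')/G') · H(G'; D₁, …, D_p)
≤ H(G; c₁D₁, …, c_pD_p)`."

Supplements printed in the same paper and used for the readings below: §3, (*) p. 362 and
Lemme 3.1, p. 364: `H(V; d) = (dim V)! ∑_α deg_α(V) d^α/(α₁!⋯α_p!)`, the sum over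
`0 ≤ αᵢ ≤ Nᵢ`, `|α| = dim V`, with `deg_α(V) = max card(V ∩ L₁ × ⋯ × L_p)` over linear
subvarieties `Lᵢ ⊂ ℙ_{Nᵢ}` of codimension `αᵢ` meeting `V` in dimension `0` (`0` if there are
none), non-negative integers (p. 359, p. 364); Lemme 3.4, p. 371:
`H(V₁ × ⋯ × V_p; d) = (dim V)!/(∏ (dim Vᵢ)!) · ∏ deg Vᵢ · ∏ dᵢ^{dim Vᵢ}`; §4.1, p. 372 and
Lemme 4.5, p. 376: `cᵢ` is the degree, in the homogeneous coordinates of `ℙ_{Nᵢ}`, of polynomial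
formulas representing `(h, z) ↦ h + Φ(z)` on a Zariski cover, resp. a bound for the degrees of
the formulas representing the translations of `Gᵢ` ("Moreau a remarqué que … l'on peut prendre
`c₁ = ⋯ = c_p = 1` … pourvu que … le plongement … permet pour tout `g ∈ G` de prolonger le
morphisme `τ_g` de translation … en un morphisme de `ℙ`", pp. 375–376). The 1987 errata (ibid.
115, pp. 397–398) list typographical corrections and add that `P` in fact vanishes on all the
translates `σ + G'`, `σ ∈ Σ` (a strengthening, not used here).

## What is vendored (the case `T = 0`, `G = 𝔾ₐ × 𝔾ₘⁿ ⊂ ℙ¹ × (ℙ¹)ⁿ`; readings, each a weakening)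

* `T = 0`: the binomial factor is `1`, and "`P` s'annule à un ordre `≥ 1` le long de `A` en `g`"
  is `P(g) = 0` whatever the analytic subgroup `A` (take `Φ = exp_G` on `Lie G`), so neither `Φ`
  nor `codim_A` appears.
* `p = n + 1`, `G₀ = 𝔾ₐ ⊂ ℙ¹` (`x ↦ (1 : x)`), `G_h = 𝔾ₘ ⊂ ℙ¹` (`y ↦ (1 : y)`), all `nᵢ = Nᵢ = 1`,
  `dim G = n + 1`; the translations `(X₀ : X₁) ↦ (X₀ : X₁ + aX₀)` and `(Y₀ : Y₁) ↦ (Y₀ : bY₁)`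
  (and `(h, z) ↦ h + exp_G(z)` alike) are linear in the homogeneous coordinates, so `cᵢ = 1`
  (as in Nesterenko–Philippon (eds.) 2001, Ch. 11, §2.1, Example, p. 199: `c(G) = 1` for the linear
  torus); hence, by Lemme 3.4 with `deg Gᵢ = 1`, `H(G; D₀, D₁, …, D₁) = (n+1)! D₀D₁ⁿ`.
* A nonzero affine `P ∈ ℂ[X, Y₁, …, Y_n]` with `deg_X P ≤ D₀` and `deg_{Y_h} P ≤ D₁` for every `h`
  is the dehomogenisation of a nonzero form of multidegree exactly `(D₀, D₁, …, D₁)` (pad with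
  powers of `X₀`, `Y_{h,0}`, which do not vanish on `G`); all points of `G(ℂ) = ℂ × (ℂˣ)ⁿ` lie in
  the standard affine chart, where `evalAt` evaluates; `Σ(n+1)` is `sumset S (n + 1)`.
* The connected algebraic subgroups are `G' = V × T_A`, `V ∈ {0, 𝔾ₐ}` (`addDim ∈ {0, 1}`),
  `T_A = ⋂_{χ ∈ A} ker χ` for a saturated `A ≤ ℤⁿ`, `dim T_A = torusDim`; "`G'` contenu dans un
  translaté de `G ∩ 𝒵(P)`" is `∃ g, ∀ h ∈ G', P(gh) = 0` (in particular `G' ≠ G` as `P ≠ 0`).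
* `H(G'; D₀, D₁, …, D₁) ≥ D₀^{addDim} D₁^{torusDim}`: by (*) every `deg_α(G') ≥ 0`, and for
  `α = (addDim; 𝟙_β)` with `β ⊂ {1, …, n}` a set of `torusDim` coordinates on which `T_A` projects
  dominantly, `deg_α(G') ≥ 1` (a generic fibre of a dominant equidimensional projection is finite
  and non-empty); here `αᵢ! = 1`. This gives conclusion (i).
* If moreover `V = 𝔾ₐ` and `A = ℤλ` (`T_A` the hypersurface `y^λ = 1`, `λ` primitive as `A` is
  saturated; `λ = 0` makes (ii) read `0 ≤ …`), then `dim G' = n`, the closure of `G'` in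
  `(ℙ¹)^{n+1}` is `ℙ¹ ×` the irreducible hypersurface `y^{λ⁺} = y^{λ⁻}` of multidegree
  `(0, |λ₁|, …, |λ_n|)`, and (*) reads `H(G'; D₀, D₁, …, D₁) = n! D₀D₁^{n-1} ∑_h |λ_h|`
  (`deg_α = |λ_h|` for `α = (1; 𝟙_{[n]∖{h}})`: fixing the other coordinates generically, `y^λ = c`
  has `|λ_h|` solutions in `y_h`; the terms with `α₀ = 0` vanish), whence conclusion (ii) by
  dividing the printed inequality by `n!`:
  `card · D₀D₁^{n-1} (∑_h |λ_h|) ≤ (n+1)! D₀D₁ⁿ / n! = (n+1) D₀D₁ⁿ`.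
* The degree clause, conclusion (iii): `A ⊗ ℚ` is spanned by the characters `λ ∈ A` with
  `|λ_h| ≤ D₁` for all `h`. Indeed let `A'` be the saturation of the group generated by those; if
  `A' ≠ A` then `V × T_{A'}` is an irreducible subvariety of `G` strictly containing the component
  `G' = V × T_A` of `G ∩ 𝒵(I)`, so some generator `F` of `I` (multidegree `≤ (D₀, D₁, …, D₁)`, as
  `cᵢ = 1`) vanishes on `G'` but not on `V × T_{A'}`; a suitable coefficient `f(y)` of `F` (w.r.t.
  `x` if `V = 𝔾ₐ`, or `F(0, y)` if `V = 0`) is then a polynomial of partial degrees `≤ D₁`, zero on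
  `T_A`, not identically zero on `T_{A'}`; restricting its monomials to the torus `T_{A'}` and using
  the linear independence of distinct characters of the connected tori `T_{A'}`, `T_A`, two of its
  monomials `y^e, y^{e'}` differ on `T_{A'}` and agree on `T_A`, i.e. `λ = e - e' ∈ A ∖ A'` with
  `|λ_h| ≤ D₁` — contradicting the definition of `A'`.

Deliberately NOT here: multiplicities (`T ≥ 1`, analytic subgroups; see `Philippon1986_GaGm` and
`philippon1986_std` for vendored multiplicity versions), the value of Philippon's constants for
other embeddings, the factor `(dim G')!` and the remaining terms of `H(G'; D)` (dropped, a
weakening), the 1987 addendum. Users take `(h : Philippon1986_GaGm_P1n)`, fed by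
`Philippon1986_GaGm_P1n_holds` (`PhilipponZeroEstimateP1nProofs.lean`).
The derivation of `Diaz1989_zeroLemma` from this fact is `DiazZeroLemmaProofs.lean`.

## Proof status

PROVED: `Philippon1986_GaGm_P1n_holds` in `PhilipponZeroEstimateP1nProofs.lean` (2026-08-15). The
discharge is Philippon's §3 + §5 specialised to `(ℙ¹)^{n+1}` at `T = 0`, organised as follows in the
tree: (1) Zariski-closed subsets of `G(ℂ) = ℂ × (ℂˣ)ⁿ`, components = minimal primes, Krull
dimension and Krull's principal ideal theorem for sections (`GaGmZariski.lean`); (2) the box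
filtration `Box(t)` (the standard grading of the Segre–Veronese embedding of `(ℙ¹)ⁿ⁺¹` by
`𝒪(D₀, D₁, …, D₁)`), its Hilbert functions, the multiplicity `GaGm.mult` with
`mult(G) = (n+1)! D₀ D₁ⁿ`, and the Bézout inequality for box polynomials — op. cit. Prop. 3.3 at
`T = 0`, set-theoretic top-dimensional form (`GaGmBezout.lean`, on
`Literature.RingTheory.HilbertSamuel.FilteredHilbertFunction`); (3) closed subgroups of `G(ℂ)`:
Jordan decomposition, identity component of finite index, duality and saturation of characters, the
structure theorem `V × T_A` (`GaGmSubgroups.lean`), `dim = dim V + dim T_A` and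
`mult ≥ D₀^{dim V} D₁^{dim T_A}` (`GaGmSubgroupDegrees.lean`) — reading (i); (4) the descent of §5
at `T = 0` (`PhilipponZeroEstimateP1nDescent.lean`: `GaGm.exists_obstruction_subgroup`); (5) the
multiplicity of `𝔾ₐ × T_λ`, `mult ≥ n!·D₀D₁ⁿ⁻¹·∑|λ_h|` (`PhilipponZeroEstimateP1nMultBound.lean`) —
reading (ii); (6) the degree clause (`PhilipponZeroEstimateP1nDegreeClause.lean`) — reading (iii).
The case `n = 0` is also checked directly below (`Philippon1986_GaGm_P1n_caseZero`, root counting).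

## References

* P. Philippon, *Lemmes de zéros dans les groupes algébriques commutatifs*, Bull. Soc. Math.
  France 114 (1986), 355–383 (doi:10.24033/bsmf.2060), §2 Théorème 2.1 (p. 358), p. 360,
  §3 (*) p. 362, Lemmes 3.1–3.2 pp. 363–364, Lemme 3.4 p. 371, Prop. 3.3 p. 365, §4.1 p. 372,
  Lemme 4.5 p. 376, §5 pp. 380–383; Errata et addenda, ibid. 115 (1987), 397–398
  (doi:10.24033/bsmf.2084).
* Yu. V. Nesterenko, P. Philippon (eds.), *Introduction to Algebraic Independence Theory*,
  LNM 1752, Springer 2001, Ch. 11 (D. Roy), §2.1 Example (p. 199), Theorem 4.1 (p. 218);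
  Ch. 14, Prop. 3.6 (p. 254: the same theorem used with `W = 0`, i.e. without multiplicities).
* G. Diaz, *Grands degrés de transcendance pour des familles d'exponentielles*, J. Number Theory
  31 (1989), 1–23, §II-3-4, Lemme de zéros, pp. 11–12 (the application).
-/

noncomputable section

namespace Literature.NumberTheory.Transcendental

open GaGm in
/-- **Philippon's zero estimate on `𝔾ₐ × 𝔾ₘⁿ ⊂ ℙ¹ × (ℙ¹)ⁿ`, multiplicity-free, with the degree
clause** (Philippon 1986, Théorème 2.1, case `K = ℂ`, `T = 0`, `p = n + 1` factors `𝔾ₐ, 𝔾ₘ, …, 𝔾ₘ`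
each in `ℙ¹`, `cᵢ = 1`; see the module docstring for the printed statement and the readings). For
integers `D₀, D₁ ≥ 1`, a finite `Σ ∋ e`, and a non-zero `P ∈ ℂ[X, Y₁, …, Y_n]` with `deg_X P ≤ D₀`,
`deg_{Y_h} P ≤ D₁` (`1 ≤ h ≤ n`) vanishing at every point of `Σ(n+1)`, there is a connected
algebraic subgroup `G' = V × T_A` of `G` contained in a translate of the zero set of `P`, such that:
(i) `card((Σ·G')/G') · D₀^{dim V} · D₁^{dim T_A} ≤ (n+1)! D₀ D₁ⁿ`;
(ii) if `V = 𝔾ₐ` and `A = ℤλ`, `card((Σ·G')/G') · D₀ D₁^{n-1} ∑_h |λ_h| ≤ (n+1) D₀ D₁ⁿ`;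
(iii) `A` is rationally spanned by its elements `λ` with `max_h |λ_h| ≤ D₁`.
Users take `(h : Philippon1986_GaGm_P1n)`.
[cite: Philippon1986, Thm 2.1 (p. 358), case T = 0, with §3 (*) p. 362, Lemme 3.4 p. 371, Lemme 4.5 p. 376 (G = 𝔾ₐ × 𝔾ₘⁿ ⊂ (ℙ¹)ⁿ⁺¹, cᵢ = 1)] -/
def Philippon1986_GaGm_P1n : Prop :=
  ∀ (n D₀ D₁ : ℕ) (S : Set (GaGm n)) (P : MvPolynomial (Fin (n + 1)) ℂ),
    1 ≤ D₀ → 1 ≤ D₁ → S.Finite → (1 : GaGm n) ∈ S → P ≠ 0 →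
    P.degreeOf 0 ≤ D₀ → (∀ h : Fin n, P.degreeOf h.succ ≤ D₁) →
    (∀ g ∈ sumset S (n + 1), evalAt P g = 0) →
    ∃ H : ConnAlgSubgroup n,
      (∃ g : GaGm n, ∀ h ∈ H.toSubgroup, evalAt P (g * h) = 0) ∧
      Set.ncard ((QuotientGroup.mk : GaGm n → GaGm n ⧸ H.toSubgroup) '' S) *
        D₀ ^ H.addDim * D₁ ^ H.torusDim ≤ (n + 1).factorial * D₀ * D₁ ^ n ∧
      (∀ lam : Fin n → ℤ, H.addPart = true → H.chars = AddSubgroup.zmultiples lam →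
        Set.ncard ((QuotientGroup.mk : GaGm n → GaGm n ⧸ H.toSubgroup) '' S) *
          D₀ * D₁ ^ (n - 1) * (∑ h, (lam h).natAbs) ≤ (n + 1) * D₀ * D₁ ^ n) ∧
      (∃ Λ : Finset (Fin n → ℤ), (↑Λ : Set (Fin n → ℤ)) ⊆ H.chars ∧
        (∀ lam ∈ Λ, ∀ h, |lam h| ≤ D₁) ∧
        ∀ χ ∈ H.chars, ∃ k : ℤ, k ≠ 0 ∧ k • χ ∈ AddSubgroup.closure (↑Λ : Set (Fin n → ℤ)))

open GaGm in
/-- **The form used by Diaz's zero lemma** (`DiazZeroLemmaProofs.lean`): the fact for `n ≥ 1`,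
with the hypotheses in the order the application supplies them. (Kept with the signature it had
when the fact still carried multiplicities, so that its users are unchanged; it is now the fact
itself.) [cite: Philippon1986, Thm 2.1 (T = 0)] -/
theorem Philippon1986_GaGm_P1n.vanishing (hP : Philippon1986_GaGm_P1n) {n D₀ D₁ : ℕ}
    (_hn : 1 ≤ n) {S : Set (GaGm n)} {P : MvPolynomial (Fin (n + 1)) ℂ} (hD₀ : 1 ≤ D₀)
    (hD₁ : 1 ≤ D₁) (hS : S.Finite) (h1 : (1 : GaGm n) ∈ S) (hP0 : P ≠ 0)
    (hdeg₀ : P.degreeOf 0 ≤ D₀) (hdeg : ∀ h : Fin n, P.degreeOf h.succ ≤ D₁)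
    (hvan : ∀ g ∈ sumset S (n + 1), evalAt P g = 0) :
    ∃ H : ConnAlgSubgroup n,
      (∃ g : GaGm n, ∀ h ∈ H.toSubgroup, evalAt P (g * h) = 0) ∧
      Set.ncard ((QuotientGroup.mk : GaGm n → GaGm n ⧸ H.toSubgroup) '' S) *
        D₀ ^ H.addDim * D₁ ^ H.torusDim ≤ (n + 1).factorial * D₀ * D₁ ^ n ∧
      (∀ lam : Fin n → ℤ, H.addPart = true → H.chars = AddSubgroup.zmultiples lam →
        Set.ncard ((QuotientGroup.mk : GaGm n → GaGm n ⧸ H.toSubgroup) '' S) *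
          D₀ * D₁ ^ (n - 1) * (∑ h, (lam h).natAbs) ≤ (n + 1) * D₀ * D₁ ^ n) ∧
      (∃ Λ : Finset (Fin n → ℤ), (↑Λ : Set (Fin n → ℤ)) ⊆ H.chars ∧
        (∀ lam ∈ Λ, ∀ h, |lam h| ≤ D₁) ∧
        ∀ χ ∈ H.chars, ∃ k : ℤ, k ≠ 0 ∧ k • χ ∈ AddSubgroup.closure (↑Λ : Set (Fin n → ℤ))) :=
  hP n D₀ D₁ S P hD₀ hD₁ hS h1 hP0 hdeg₀ hdeg hvan

open GaGm in
/-- **The case `n = 0` (`G = 𝔾ₐ ⊂ ℙ¹`) of the fact, proved**: a non-zero `P ∈ ℂ[X]` of degree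
`≤ D₀` vanishing on a finite `Σ ∋ 0` forces `card Σ ≤ D₀` (root counting); the obstruction subgroup
is `{e}` (`H(𝔾ₐ; D₀) = 1!·D₀`, `H({e}; D₀) = 1`), and (ii), (iii) are empty. This is literally the
body of `Philippon1986_GaGm_P1n` at `n = 0` (a sanity check of the encoding, not used elsewhere).
[cite: Philippon1986, Thm 2.1 (G = 𝔾ₐ, T = 0)] -/
theorem Philippon1986_GaGm_P1n_caseZero :
    ∀ (D₀ D₁ : ℕ) (S : Set (GaGm 0)) (P : MvPolynomial (Fin (0 + 1)) ℂ),
      1 ≤ D₀ → 1 ≤ D₁ → S.Finite → (1 : GaGm 0) ∈ S → P ≠ 0 →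
      P.degreeOf 0 ≤ D₀ → (∀ h : Fin 0, P.degreeOf h.succ ≤ D₁) →
      (∀ g ∈ sumset S (0 + 1), evalAt P g = 0) →
      ∃ H : ConnAlgSubgroup 0,
        (∃ g : GaGm 0, ∀ h ∈ H.toSubgroup, evalAt P (g * h) = 0) ∧
        Set.ncard ((QuotientGroup.mk : GaGm 0 → GaGm 0 ⧸ H.toSubgroup) '' S) *
          D₀ ^ H.addDim * D₁ ^ H.torusDim ≤ (0 + 1).factorial * D₀ * D₁ ^ 0 ∧
        (∀ lam : Fin 0 → ℤ, H.addPart = true → H.chars = AddSubgroup.zmultiples lam →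
          Set.ncard ((QuotientGroup.mk : GaGm 0 → GaGm 0 ⧸ H.toSubgroup) '' S) *
            D₀ * D₁ ^ (0 - 1) * (∑ h, (lam h).natAbs) ≤ (0 + 1) * D₀ * D₁ ^ 0) ∧
        (∃ Λ : Finset (Fin 0 → ℤ), (↑Λ : Set (Fin 0 → ℤ)) ⊆ H.chars ∧
          (∀ lam ∈ Λ, ∀ h, |lam h| ≤ D₁) ∧
          ∀ χ ∈ H.chars, ∃ k : ℤ, k ≠ 0 ∧
            k • χ ∈ AddSubgroup.closure (↑Λ : Set (Fin 0 → ℤ))) := by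
  intro D₀ D₁ S P _hD₀ _hD₁ hS h1 hP0 hdeg₀ _hdeg hvan
  classical
  -- the univariate polynomial `q(y) = P(y)` (there are no torus variables)
  set s : Fin 0 → ℂ := fun j => j.elim0 with hs_def
  set q : Polynomial ℂ :=
    Polynomial.map (MvPolynomial.eval s) (MvPolynomial.finSuccEquiv ℂ 0 P) with hq_def
  have hevalq : ∀ y : ℂ,
      Polynomial.eval y q = MvPolynomial.eval (Fin.cons y s : Fin (0 + 1) → ℂ) P :=
    fun y => (MvPolynomial.eval_eq_eval_mv_eval' s y P).symm
  have hcons : ∀ x : Fin (0 + 1) → ℂ, x = Fin.cons (x 0) s := fun x => by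
    funext i
    refine Fin.cases ?_ (fun j => j.elim0) i
    simp
  have hq0 : q ≠ 0 := by
    intro hq0
    apply hP0
    apply MvPolynomial.funext
    intro x
    have h := hevalq (x 0)
    rw [hq0, Polynomial.eval_zero, ← hcons x] at h
    rw [map_zero, ← h]
  have hdegq : q.natDegree ≤ D₀ :=
    Polynomial.natDegree_map_le.trans ((MvPolynomial.natDegree_finSuccEquiv P).le.trans hdeg₀)
  -- `P` vanishes on `Σ ⊆ Σ(1)`
  have hvanS : ∀ g ∈ S, evalAt P g = 0 := fun g hg =>
    hvan g (subset_sumset h1 (by norm_num) hg)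
  have hcoord : ∀ g : GaGm 0, coord g = Fin.cons (Multiplicative.toAdd g.1) s := fun g => by
    funext i
    refine Fin.cases ?_ (fun j => j.elim0) i
    simp
  -- `Σ` injects into the roots of `q`
  have hroot : ∀ g ∈ S, Multiplicative.toAdd g.1 ∈ q.roots := fun g hg => by
    rw [Polynomial.mem_roots hq0, Polynomial.IsRoot.def, hevalq, ← hcoord]
    exact hvanS g hg
  have hinj : Set.InjOn (fun g : GaGm 0 => Multiplicative.toAdd g.1) S := by
    intro g _ g' _ h
    exact Prod.ext (Multiplicative.toAdd.injective h) (Subsingleton.elim _ _)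
  have hcardS : S.ncard ≤ D₀ := by
    have h1 : S.ncard ≤ (↑q.roots.toFinset : Set ℂ).ncard :=
      Set.ncard_le_ncard_of_injOn (fun g : GaGm 0 => Multiplicative.toAdd g.1)
        (fun g hg => by simpa using hroot g hg) hinj
    calc S.ncard ≤ (↑q.roots.toFinset : Set ℂ).ncard := h1
      _ = q.roots.toFinset.card := Set.ncard_coe_finset _
      _ ≤ Multiset.card q.roots := Multiset.toFinset_card_le _
      _ ≤ q.natDegree := Polynomial.card_roots' q
      _ ≤ D₀ := hdegq
  have htd : (ConnAlgSubgroup.bot 0).torusDim = 0 := by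
    apply Nat.eq_zero_of_le_zero
    calc (ConnAlgSubgroup.bot 0).torusDim
        = Module.finrank ℂ ↥(ConnAlgSubgroup.bot 0).torusTangent := rfl
      _ ≤ Module.finrank ℂ (Fin 0 → ℂ) := Submodule.finrank_le _
      _ = 0 := by simp
  have had : (ConnAlgSubgroup.bot 0).addDim = 0 := by
    simp [ConnAlgSubgroup.addDim, ConnAlgSubgroup.bot]
  refine ⟨ConnAlgSubgroup.bot 0, ⟨1, fun h hh => ?_⟩, ?_, ?_, ⟨∅, by simp, by simp, fun χ _ => ?_⟩⟩
  · rw [(ConnAlgSubgroup.mem_toSubgroup_bot_iff h).mp hh, mul_one]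
    exact hvanS 1 h1
  · rw [htd, had]
    have h2 : Set.ncard ((QuotientGroup.mk : GaGm 0 → GaGm 0 ⧸ (ConnAlgSubgroup.bot 0).toSubgroup)
        '' S) ≤ D₀ := (Set.ncard_image_le hS).trans hcardS
    simpa using h2
  · intro lam h _
    simp [ConnAlgSubgroup.bot] at h
  · refine ⟨1, one_ne_zero, ?_⟩
    rw [Subsingleton.elim ((1 : ℤ) • χ) 0]
    exact AddSubgroup.zero_mem _

end Literature.NumberTheory.Transcendental

end
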